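import Summits.AtomisticToContinuum.HydrodynamicLimit.Theses.InformationPercolationEngine
import Summits.AtomisticToContinuum.HydrodynamicLimit.Theorems.JParityClosureCollisionTightnessDomination
import Literature.MathematicalPhysics.KineticTheory.HardSphereEulerProofs
import HarnessLib

/-!
# `InformationPercolationEngine.KickFairRelEquilibrium` (stmt-AtomisticToContinuum-14914): the
# transfer to local Gibbs data — the crux follows from equilibrium super-exponential tails

Helper file (`--supports stmt-AtomisticToContinuum-14914`) of the line `Sketch` (card
`affine-fibre-statics`, composed form; crux workfile `Cruxes/KickFairRelEquilibrium/Lines/Sketch.lean`).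
It lands STAGE 1 of the line — `TransferToLocalGibbs` of the route's two-layer plan — sorry-free.
Since rev 12 of the route (2026-08-16T12:31:18Z) the crux decl `KickFairRelEquilibrium` is RETIRED
(replaced by the mesoscopic restatement `KickFairRelEquilibriumMeso`, stmt-AtomisticToContinuum-15177)
and the route file `Theses.InformationPercolationEngine` no longer declares it; it is re-declared below,
in the route's namespace and with the item's signature VERBATIM (on one line, as the route file rendered
it), solely so that this record of the transfer keeps elaborating with its statement unchanged — the
statement of the decl is unchanged, only its home moved, and nothing of the route is asserted positively.


* `Theses.InformationPercolationEngine.KickFairRelEquilibrium` — the retired crux decl, re-declared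
  verbatim (other files needing the retired decl should import this module rather than re-declare the
  same name, or re-home a copy under their own namespace).
* `KickFairRelEquilibriumTransfer.lintegral_ofReal_abs_le_of_le_smul` — if a probability measure `μ` is
  dominated by `c • ν` then `∫⁻ |S| dμ ≤ δ + c ∫⁻ (|S| − δ)₊ dν` for EVERY real function `S` (no
  measurability: the lower Lebesgue integral is monotone in the measure).
* `KickFairRelEquilibriumTransfer.pow_mul_exp_neg_log_add_one` — `Λ^{N+1} e^{−(log Λ+1)(N+1)} = e^{−(N+1)}`.
* `KickFairRelEquilibrium_of_eqKickTail` — **the reduction**: IF under the HOMOGENEOUS (flow-invariant)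
  Gibbs laws `G_N = localGibbsLaw σ 1 0 θ₁ N (Φ N)`, for every temperature `θ₁ > 0`, all small `σ`, every
  flow family, horizon, cell size, bounded continuous kick test `g`, every `δ > 0` and EVERY rate `K`,
  the δ-excess of the decl's centred kick sum `S_h` is eventually `≤ e^{−K(N+1)}` in `L¹(G_N)` uniformly
  over admissible weights `h` (the hypothesis `hEq`, = the registered stub `stub_eqKickTail` of the
  skeleton, stated inline), THEN `KickFairRelEquilibrium` holds: by
  `exists_localGibbsMeasure_le_smul_const` (`localGibbsMeasure σ a₀ u₀ θ₀ N ≤ Λ^{N+1} • G_{θ₁}`,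
  `θ₁ = 2 sup θ₀`, all `σ ≤ 1/2`) and `localGibbsLaw_eq`,
  `E_{LG}|S_h| ≤ δ/2 + Λ^{N+1} e^{−(log Λ + 1)(N+1)} = δ/2 + e^{−(N+1)} ≤ δ`.

Why the centring needs no change of temperature: the decl's `κ` is Mathlib's `condExp` under `G_1`;
`dG_{θ₁}/dG_1 ∝ exp((1/2 − 1/(2θ₁)) Σ|v_i|²)` is a function of the conserved kinetic energy, which the
typed past (all exact velocities at a flight start) determines, so `κ` is also the conditional mean
under every `G_{θ₁}` — this remark is not used in the proof (the hypothesis carries the decl's `S_h`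
verbatim) but explains why `hEq` is the natural equilibrium statement.

What is NOT proved, and why. `hEq` is the entire dynamical content of the crux (the equilibrium half in
large-deviation strength, `EqKickSuperexp(centred)`); it is OPEN, and the crux analysis memo
`Cruxes/KickFairRelEquilibrium/Analysis-r1-k1.md` §F4 argues it is FALSE at fixed cell size `r`
(sub-cell hydrodynamic modes give a speed-`N` large-deviation LOWER bound under `G`), plausible only for
cells `r_N → 0` with `ε ≪ r_N ≪ N^{-1/6}`. The exponential loss `Λ^{N+1}` is intrinsic to any global
comparison of a local Gibbs law with an invariant law (relative entropy of order `N`), which is why a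
speed-`N` bound is not enough and the hypothesis asks for every rate `K`.

References: H. Spohn, *Large Scale Dynamics of Interacting Particles* (1991), Part I §2.3–§3 (local
equilibrium; relative entropy of order `N`); C. Kipnis, C. Landim, *Scaling Limits of Interacting
Particle Systems* (1999), App. 1.8 (the entropy inequality this measure-form comparison replaces).
-/

noncomputable section

open MeasureTheory Set Filter Topology
open scoped ENNReal Classical

/-! ### The retired crux decl, re-declared (route rev 12 dropped it) -/

namespace Summit.AtomisticToContinuum.HydrodynamicLimit.Theses.InformationPercolationEngine

/-- RETIRED route decl `KickFairRelEquilibrium` (crux stmt-AtomisticToContinuum-14914 of route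
InformationPercolationEngine, the rev 5–11 kick crux; HELD under the negative lemma
`KickFairRelEquilibriumNegative.KickFairRelEquilibrium_false_of_SubcellClusteringBiasPersists` and then
REPLACED at rev 12, 2026-08-16T12:31:18Z, by `KickFairRelEquilibriumMeso`, stmt-AtomisticToContinuum-15177;
the generated route file keeps it only as a comment): KICKS ARE AS FAIR AS IN EQUILIBRIUM, GIVEN THE TYPED
COARSE PAST, at FIXED cell size `r` — for continuous positive profiles `a₀, θ₀` and continuous `u₀` there is
`σ₀ > 0` such that for all `0 < σ < σ₀`, every flow family `Φ`, horizon `τ > 0`, cell size `r > 0`, bounded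
continuous kick test `g` and `δ > 0`, eventually in `N` and uniformly over measurable weights `|h| ≤ 1` of
the typed past `P_{i,n}` (r-cells and exact velocities of all spheres at the two flight starts, partner
label, the three times; cut to the good set), the centred kick sum
`S_h = (ε/(N+1)) Σ_i Σ_{n < cnt_i} h(P_{i,n}) (g(X_{i,n}) − κ_{i,n})`, `κ = E_G[g(X) | σ(P)]` Mathlib's
`condExp` under the INVARIANT law `G = localGibbsLaw σ 1 0 1 N (Φ N)`, has `E_{LG}|S_h| ≤ δ` under the local
Gibbs law. Re-declared here, in the route's namespace and with the item's signature verbatim, solely so that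
`KickFairRelEquilibrium_of_eqKickTail` below keeps elaborating with its statement unchanged (the crux
workfiles `Cruxes/KickFairRelEquilibrium/{Disproof, Lines/Sketch}.lean`, which import this module, refer to
the same name); a definition, not a cited fact, and not asserted. Other files must not re-declare this name:
import this module, or re-home a copy under their own namespace. -/
def KickFairRelEquilibrium : Prop :=
  ∀ (a₀ θ₀ : Literature.MathematicalPhysics.KineticTheory.T3 → ℝ) (u₀ : Literature.MathematicalPhysics.KineticTheory.T3 → Literature.MathematicalPhysics.KineticTheory.V3), Continuous a₀ → Continuous θ₀ → Continuous u₀ → (∀ x, 0 < a₀ x) → (∀ x, 0 < θ₀ x) → ∃ σ₀ : ℝ, 0 < σ₀ ∧ ∀ σ : ℝ, 0 < σ → σ < σ₀ → ∀ Φ : (N : ℕ) → Literature.Analysis.FluidPDE.HardSphereFlow (Literature.Analysis.FluidPDE.Torus.geometry (Fin 3)) (Literature.MathematicalPhysics.KineticTheory.hsDiameter σ N) (N + 1), ∀ τ : ℝ, 0 < τ → ∀ r : ℝ, 0 < r → ∀ g : Literature.MathematicalPhysics.KineticTheory.V3 × Literature.MathematicalPhysics.KineticTheory.V3 × Literature.MathematicalPhysics.KineticTheory.V3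 → ℝ, Continuous g → (∃ C : ℝ, ∀ p, |g p| ≤ C) → ∀ δ : ℝ, 0 < δ → ∃ N₀ : ℕ, ∀ N : ℕ, N₀ ≤ N → ∀ h : Fin (N + 1) → ℕ → (((Fin (N + 1) → (Fin 3 → ℤ) × Literature.MathematicalPhysics.KineticTheory.V3) × (Fin (N + 1) → (Fin 3 → ℤ) × Literature.MathematicalPhysics.KineticTheory.V3)) × Fin (N + 1)) × (ℝ × ℝ × ℝ) → ℝ, (∀ i n, Measurable (h i n)) → (∀ i n p, |h i n p| ≤ 1) → let ε := Literature.MathematicalPhysics.KineticTheory.hsDiameter σ N; let G : Literature.Analysis.FluidPDE.Geometry (Fin 3) Literature.MathematicalPhysics.KineticTheory.T3 := Literature.Analysis.FluidPDE.Torus.geometry (Fin 3); let q : Literature.MathematicalPhysics.KineticTheory.T3 → (Fin 3 → ℤ) := Literature.Analysis.FluidPDE.Torus.coarseCell r; let γ : Literature.Analysis.FluidPDE.Config (N + 1) (Fin 3) Literature.MathematicalPhysics.KineticTheory.T3 → ℝ → Literature.Analysis.FluidPDE.Config (N + 1) (Fin 3) Literature.MathematicalPhysics.KineticTheory.T3 :=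 fun z s => (Φ N).flow s z; let cnt : Literature.Analysis.FluidPDE.Config (N + 1) (Fin 3) Literature.MathematicalPhysics.KineticTheory.T3 → Fin (N + 1) → ℕ := fun z i => Set.ncard (Literature.Analysis.FluidPDE.collisionTimesOf G ε (γ z) i ∩ Set.Ioc 0 τ); let P : Literature.Analysis.FluidPDE.Config (N + 1) (Fin 3) Literature.MathematicalPhysics.KineticTheory.T3 → Fin (N + 1) → ℕ → (((Fin (N + 1) → (Fin 3 → ℤ) × Literature.MathematicalPhysics.KineticTheory.V3) × (Fin (N + 1) → (Fin 3 → ℤ) × Literature.MathematicalPhysics.KineticTheory.V3)) × Fin (N + 1)) × (ℝ × ℝ × ℝ) := fun z i n => if z ∈ (Φ N).good then (((Φ N).coarsePastOf q i n z, (Φ N).nthPartnerOf i n z), (Literature.Analysis.FluidPDE.flightStart G ε (γ z) 0 i ((Φ N).nthCollisionTimeOf i n z), Literature.Analysis.FluidPDE.flightStart G ε (γ z) 0 ((Φ N).nthPartnerOf i n z) ((Φ N).nthCollisionTimeOf i n z), (Φ N).nthCollisionTimeOf i n z)) else (((fun _ => (0, 0), fun _ => (0, 0)), 0), (0, 0,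 0)); let X : Fin (N + 1) → ℕ → Literature.Analysis.FluidPDE.Config (N + 1) (Fin 3) Literature.MathematicalPhysics.KineticTheory.T3 → Literature.MathematicalPhysics.KineticTheory.V3 × Literature.MathematicalPhysics.KineticTheory.V3 × Literature.MathematicalPhysics.KineticTheory.V3 := fun i n z => if z ∈ (Φ N).good then (((Φ N).nthRecordOf i n z).impactVec, ((Φ N).nthRecordOf i n z).preVel) else 0; let κ : Fin (N + 1) → ℕ → Literature.Analysis.FluidPDE.Config (N + 1) (Fin 3) Literature.MathematicalPhysics.KineticTheory.T3 → ℝ := fun i n => MeasureTheory.condExp (MeasurableSpace.comap (fun z => P z i n) inferInstance) (Literature.MathematicalPhysics.KineticTheory.localGibbsLaw σ (fun _ => 1) (fun _ => 0) (fun _ => 1) N (Φ N)) (fun z => g (X i n z)); let S : Literature.Analysis.FluidPDE.Config (N + 1) (Fin 3) Literature.MathematicalPhysics.KineticTheory.T3 → ℝ := fun z => ε / (N + 1 : ℝ) * ∑ i : Fin (N + 1), ∑ n ∈ Finset.range (cnt z i), h i n (P z i n) * (g (X i n z) - κ i n z); ∫⁻ z, ENNReal.ofReal |S z| ∂(Literature.MathematicalPhysics.KineticTheory.localGibbsLaw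 σ a₀ u₀ θ₀ N (Φ N)) ≤ ENNReal.ofReal δ

end Summit.AtomisticToContinuum.HydrodynamicLimit.Theses.InformationPercolationEngine

namespace Summit.AtomisticToContinuum.HydrodynamicLimit.Theorems

open Literature.Analysis.FluidPDE Literature.MathematicalPhysics.KineticTheory

namespace KickFairRelEquilibriumTransfer

/-- **Domination transfer for lower integrals.** If a probability measure `μ` is dominated by
`c • ν`, then for every real function `S` (no measurability needed) and every real `δ`,
`∫⁻ |S| dμ ≤ δ₊ + c · ∫⁻ (|S| − δ)₊ dν`: split `|S| ≤ δ + (|S| − δ)` pointwise under `ENNReal.ofReal`,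
integrate the constant against `μ` and the excess against `c • ν`. [folklore] -/
theorem lintegral_ofReal_abs_le_of_le_smul {α : Type*} [MeasurableSpace α] {μ ν : Measure α}
    [IsProbabilityMeasure μ] {c : ℝ≥0∞} (hμν : μ ≤ c • ν) (S : α → ℝ) (δ : ℝ) :
    ∫⁻ z, ENNReal.ofReal |S z| ∂μ ≤
      ENNReal.ofReal δ + c * ∫⁻ z, ENNReal.ofReal (|S z| - δ) ∂ν := by
  calc ∫⁻ z, ENNReal.ofReal |S z| ∂μ
      ≤ ∫⁻ z, (ENNReal.ofReal δ + ENNReal.ofReal (|S z| - δ)) ∂μ := by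
        refine lintegral_mono fun z => ?_
        calc ENNReal.ofReal |S z| = ENNReal.ofReal (δ + (|S z| - δ)) := by ring_nf
          _ ≤ ENNReal.ofReal δ + ENNReal.ofReal (|S z| - δ) := ENNReal.ofReal_add_le
    _ = ENNReal.ofReal δ * μ univ + ∫⁻ z, ENNReal.ofReal (|S z| - δ) ∂μ := by
        rw [lintegral_add_left measurable_const, lintegral_const]
    _ = ENNReal.ofReal δ + ∫⁻ z, ENNReal.ofReal (|S z| - δ) ∂μ := by
        rw [measure_univ, mul_one]
    _ ≤ ENNReal.ofReal δ + ∫⁻ z, ENNReal.ofReal (|S z| - δ) ∂(c • ν) :=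
        add_le_add le_rfl (lintegral_mono' hμν le_rfl)
    _ = ENNReal.ofReal δ + c * ∫⁻ z, ENNReal.ofReal (|S z| - δ) ∂ν := by
        rw [lintegral_smul_measure, smul_eq_mul]

/-- The arithmetic of the budget: `Λ^{N+1} e^{−(log Λ + 1)(N+1)} = e^{−(N+1)}`. [folklore] -/
theorem pow_mul_exp_neg_log_add_one {Λ : ℝ} (hΛ : 0 < Λ) (N : ℕ) :
    Λ ^ (N + 1) * Real.exp (-((Real.log Λ + 1) * ((N : ℝ) + 1))) = Real.exp (-((N : ℝ) + 1)) := by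
  have hΛc : Λ * Real.exp (-(Real.log Λ + 1)) = Real.exp (-1) := by
    rw [neg_add, Real.exp_add, Real.exp_neg (Real.log Λ), Real.exp_log hΛ]
    field_simp
  rw [show -((Real.log Λ + 1) * ((N : ℝ) + 1)) = ((N + 1 : ℕ) : ℝ) * (-(Real.log Λ + 1)) by
      push_cast; ring,
    Real.exp_nat_mul, ← mul_pow, hΛc, ← Real.exp_nat_mul]
  congr 1
  push_cast
  ring

end KickFairRelEquilibriumTransfer

open KickFairRelEquilibriumTransfer in
/-- **`KickFairRelEquilibrium` follows from equilibrium super-exponential tails of the centred kick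
sum (the transfer to local Gibbs data, KL-free density route).** IF for every temperature `θ₁ > 0`
there is `σ₁ > 0` such that for all `0 < σ < σ₁`, every flow family `Φ`, horizon `τ > 0`, cell size
`r > 0`, bounded continuous `g`, every `δ > 0` and every rate `K`, eventually in `N` and uniformly over
measurable weights `|h| ≤ 1` of the typed coarse past, the decl's centred kick sum `S_h` (same
let-chain: `κ` = `condExp` under `localGibbsLaw σ 1 0 1 N (Φ N)` given the comap σ-algebra of the past)
satisfies `∫⁻ (|S_h| − δ)₊ d(localGibbsLaw σ 1 0 θ₁ N (Φ N)) ≤ e^{−K(N+1)}`, THEN the crux holds, with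
`σ₀ = min σ₁(θ₁) (1/2)` for the `θ₁, Λ` of `exists_localGibbsMeasure_le_smul_const`:
`E_{LG}|S_h| ≤ δ/2 + Λ^{N+1} ∫⁻ (|S_h| − δ/2)₊ dG_{θ₁} ≤ δ/2 + Λ^{N+1} e^{−(log Λ+1)(N+1)} = δ/2 + e^{−(N+1)} ≤ δ`.
The hypothesis is the registered stub `stub_eqKickTail` of the line `Sketch` (crux workfile
`Lines/Sketch.lean`); it is OPEN. [folklore] -/
theorem KickFairRelEquilibrium_of_eqKickTail :
    (∀ θ₁ : ℝ, 0 < θ₁ → ∃ σ₁ : ℝ, 0 < σ₁ ∧ ∀ σ : ℝ, 0 < σ → σ < σ₁ →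
      ∀ Φ : (N : ℕ) → HardSphereFlow (Torus.geometry (Fin 3)) (hsDiameter σ N) (N + 1),
      ∀ τ : ℝ, 0 < τ → ∀ r : ℝ, 0 < r →
      ∀ g : V3 × V3 × V3 → ℝ, Continuous g → (∃ C : ℝ, ∀ p, |g p| ≤ C) →
      ∀ δ : ℝ, 0 < δ → ∀ K : ℝ, ∃ N₀ : ℕ, ∀ N : ℕ, N₀ ≤ N →
      ∀ h : Fin (N + 1) → ℕ →
        (((Fin (N + 1) → (Fin 3 → ℤ) × V3) × (Fin (N + 1) → (Fin 3 → ℤ) × V3)) × Fin (N + 1)) ×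
          (ℝ × ℝ × ℝ) → ℝ,
      (∀ i n, Measurable (h i n)) → (∀ i n p, |h i n p| ≤ 1) →
      let ε := hsDiameter σ N
      let G : Geometry (Fin 3) T3 := Torus.geometry (Fin 3)
      let q : T3 → (Fin 3 → ℤ) := Torus.coarseCell r
      let γ : Config (N + 1) (Fin 3) T3 → ℝ → Config (N + 1) (Fin 3) T3 := fun z s => (Φ N).flow s z
      let cnt : Config (N + 1) (Fin 3) T3 → Fin (N + 1) → ℕ := fun z i =>
        Set.ncard (collisionTimesOf G ε (γ z) i ∩ Set.Ioc 0 τ)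
      let P : Config (N + 1) (Fin 3) T3 → Fin (N + 1) → ℕ →
          (((Fin (N + 1) → (Fin 3 → ℤ) × V3) × (Fin (N + 1) → (Fin 3 → ℤ) × V3)) × Fin (N + 1)) ×
            (ℝ × ℝ × ℝ) := fun z i n =>
        if z ∈ (Φ N).good then
          (((Φ N).coarsePastOf q i n z, (Φ N).nthPartnerOf i n z),
            (flightStart G ε (γ z) 0 i ((Φ N).nthCollisionTimeOf i n z),
              flightStart G ε (γ z) 0 ((Φ N).nthPartnerOf i n z) ((Φ N).nthCollisionTimeOf i n z),
              (Φ N).nthCollisionTimeOf i n z))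
        else (((fun _ => (0, 0), fun _ => (0, 0)), 0), (0, 0, 0))
      let X : Fin (N + 1) → ℕ → Config (N + 1) (Fin 3) T3 → V3 × V3 × V3 := fun i n z =>
        if z ∈ (Φ N).good then
          (((Φ N).nthRecordOf i n z).impactVec, ((Φ N).nthRecordOf i n z).preVel)
        else 0
      let κ : Fin (N + 1) → ℕ → Config (N + 1) (Fin 3) T3 → ℝ := fun i n =>
        MeasureTheory.condExp (MeasurableSpace.comap (fun z => P z i n) inferInstance)
          (localGibbsLaw σ (fun _ => 1) (fun _ => 0) (fun _ => 1) N (Φ N)) (fun z => g (X i n z))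
      let S : Config (N + 1) (Fin 3) T3 → ℝ := fun z =>
        ε / (N + 1 : ℝ) * ∑ i : Fin (N + 1), ∑ n ∈ Finset.range (cnt z i),
          h i n (P z i n) * (g (X i n z) - κ i n z)
      ∫⁻ z, ENNReal.ofReal (|S z| - δ)
          ∂(localGibbsLaw σ (fun _ => 1) (fun _ => 0) (fun _ => θ₁) N (Φ N)) ≤
        ENNReal.ofReal (Real.exp (-(K * ((N : ℝ) + 1))))) →
    Summit.AtomisticToContinuum.HydrodynamicLimit.Theses.InformationPercolationEngine.KickFairRelEquilibrium := by
  intro hEq a₀ θ₀ u₀ ha hθ hu ha0 hθ0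
  obtain ⟨θ₁, hθ₁, Λ, hΛ, hdom⟩ := exists_localGibbsMeasure_le_smul_const ha hθ hu ha0 hθ0
  obtain ⟨σ₁, hσ₁, H⟩ := hEq θ₁ hθ₁
  refine ⟨min σ₁ (1 / 2), lt_min hσ₁ (by norm_num), ?_⟩
  intro σ hσ hσlt Φ τ hτ r hr g hg hgb δ hδ
  have hσ₁' : σ < σ₁ := hσlt.trans_le (min_le_left _ _)
  have hσ2 : σ ≤ 1 / 2 := (hσlt.trans_le (min_le_right _ _)).le
  have hΛ0 : 0 < Λ := one_pos.trans_le hΛ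
  obtain ⟨N₀, hN₀⟩ := H σ hσ hσ₁' Φ τ hτ r hr g hg hgb (δ / 2) (half_pos hδ) (Real.log Λ + 1)
  obtain ⟨N₁, hN₁⟩ := exists_exp_neg_succ_le (half_pos hδ)
  refine ⟨max N₀ N₁, ?_⟩
  intro N hN h hhm hhb
  have hN0 : N₀ ≤ N := (le_max_left _ _).trans hN
  have hN1 : N₁ ≤ N := (le_max_right _ _).trans hN
  have hst := hN₀ N hN0 h hhm hhb
  intro ε Gm q γ cnt P X κ S
  haveI : IsProbabilityMeasure (localGibbsLaw σ a₀ u₀ θ₀ N (Φ N)) :=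
    isProbabilityMeasure_localGibbsLaw ha hθ hu ha0 hθ0 hσ2 N (Φ N)
  have hle : localGibbsLaw σ a₀ u₀ θ₀ N (Φ N) ≤
      ENNReal.ofReal (Λ ^ (N + 1)) •
        localGibbsLaw σ (fun _ => 1) (fun _ => 0) (fun _ => θ₁) N (Φ N) := by
    rw [localGibbsLaw_eq, localGibbsLaw_eq]
    exact hdom σ hσ2 N
  have htail : ∫⁻ z, ENNReal.ofReal (|S z| - δ / 2)
        ∂(localGibbsLaw σ (fun _ => 1) (fun _ => 0) (fun _ => θ₁) N (Φ N)) ≤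
      ENNReal.ofReal (Real.exp (-((Real.log Λ + 1) * ((N : ℝ) + 1)))) := hst
  calc ∫⁻ z, ENNReal.ofReal |S z| ∂(localGibbsLaw σ a₀ u₀ θ₀ N (Φ N))
      ≤ ENNReal.ofReal (δ / 2) + ENNReal.ofReal (Λ ^ (N + 1)) *
          ∫⁻ z, ENNReal.ofReal (|S z| - δ / 2)
            ∂(localGibbsLaw σ (fun _ => 1) (fun _ => 0) (fun _ => θ₁) N (Φ N)) :=
        lintegral_ofReal_abs_le_of_le_smul hle S (δ / 2)
    _ ≤ ENNReal.ofReal (δ / 2) + ENNReal.ofReal (Λ ^ (N + 1)) *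
          ENNReal.ofReal (Real.exp (-((Real.log Λ + 1) * ((N : ℝ) + 1)))) := by
        gcongr
    _ = ENNReal.ofReal (δ / 2) +
          ENNReal.ofReal (Λ ^ (N + 1) * Real.exp (-((Real.log Λ + 1) * ((N : ℝ) + 1)))) := by
        rw [ENNReal.ofReal_mul (by positivity)]
    _ = ENNReal.ofReal (δ / 2) + ENNReal.ofReal (Real.exp (-((N : ℝ) + 1))) := by
        rw [pow_mul_exp_neg_log_add_one hΛ0 N]
    _ ≤ ENNReal.ofReal (δ / 2) + ENNReal.ofReal (δ / 2) := by
        gcongr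
        exact hN₁ N hN1
    _ = ENNReal.ofReal δ := by
        rw [← ENNReal.ofReal_add (half_pos hδ).le (half_pos hδ).le, add_halves]

end Summit.AtomisticToContinuum.HydrodynamicLimit.Theorems

end
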